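import Summits.Schanuel.Schanuel.Theorems.ZilberEacGraphCurveEdge
import HarnessLib

/-!
# Line of NON-REAL slope × arbitrary curve, I: the degree-one escape engine and the escaping
# exponential points of `P(e^z, e^{az+b}) = 0`, `a ∈ ℂ ∖ ℝ`

HONEST FRAMING.  Cell `pub-schanuel` (Zilber's Exponential-Algebraic Closedness, case ladder;
host summit Schanuel), seat 2, gen 16.  Companion of the series `ZilberEacGraphCurve*` (graph
bases of degree `≥ 2`): the same Newton-polygon escape decides Mantova–Masser's OPEN density
question (PLMS 2024, §1 p. 5) for the split surfaces `{x₁ = a x₀ + b} × Z(P)` with a NON-REAL slope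
`a` and an ARBITRARY irreducible fibre polynomial `P ∉ ℂ[y₀]` (density in
`ZilberEacLineCurveComplexDensity`).  Seat 1's `ZilberEacRealFibreDensity` did the REAL irrational
slopes (a bounded, oscillatory regime: Kronecker + minimum modulus); for `Im a ≠ 0` the regime is
an ESCAPE (`Re z → -∞` linearly along the lattice direction `2πi/(a+s)`), which the real case does
not have.  NOT Schanuel's conjecture (neither used nor implied; EAC ⇏ SC); `EC(3,2)` stays OPEN.

* Part A — `tendsto_abs_re_div_log_of_linear'`: linear escape `Re z_k ≤ -L_k`,
  `‖z_k‖ ≤ A L_k + B` gives `|Re z_k| / log(2 + ‖z_k‖) → ∞` (any `A > 0`, `B ≥ 0`).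
* Part B — `exists_escape_zeros_deg_one`: the ENGINE for `R(z) = α z + β` with `Im α ≠ 0`:
  `Q(e^{R(z)}) + E(z)` (`Q(0) ≠ 0`, `deg Q > 0`, `‖E(z)‖ ≤ C_B e^{δ Re z}` for `Re z ≤ 0`,
  `|Re R(z)| ≤ B`) has zeros escaping linearly in a left half-plane.  Simpler than the degree
  `≥ 2` engine `exists_escape_zeros`: the roots `z₀ = (2πiεk + log θ - β)/α` of `e^{R(z₀)} = θ`
  are explicit, the local coordinate `z₀ + u/α` is exact (`R(z₀ + u/α) = R(z₀) + u`), and only the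
  Hurwitz persistence lemma `eventually_exists_zero_of_unif_approx` is needed.
* Part C — `exists_lineCurve_expPoints_of_im_ne_zero`: for `Im a ≠ 0` and `P` with two monomials
  of different `y₁`-degree, zeros `z_k` of `P(e^z, e^{az+b})` with `|Re z_k| / log(2 + ‖z_k‖) → ∞`
  (the edge decomposition `eval_exp_eq_mul_edgeSum` of `ZilberEacGraphCurveEdge` with
  `p = aX + b`, `R₀ = (a + s)X + b`).
-/

noncomputable section

open Filter Topology Metric Set Complex
open Literature.ModelTheory.Zilber

set_option linter.dupNamespace false

namespace Summit.Schanuel.Schanuel.Theorems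

/-! ## Part A. Growth bookkeeping with arbitrary linear constants -/

/-- **Linear escape in a left half-plane gives the growth condition** (general constants):
`Re z_k ≤ -L_k`, `‖z_k‖ ≤ A L_k + B` (`A > 0`, `B ≥ 0`), `L_k → ∞` imply
`|Re z_k| / log(2 + ‖z_k‖) → ∞`. (new) -/
theorem tendsto_abs_re_div_log_of_linear' {z : ℕ → ℂ} {L : ℕ → ℝ} (hL : Tendsto L atTop atTop)
    {A B : ℝ} (hA : 0 < A) (hB : 0 ≤ B)
    (hre : ∀ k, (z k).re ≤ -L k) (hnorm : ∀ k, ‖z k‖ ≤ A * L k + B) :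
    Tendsto (fun k => |(z k).re| / Real.log (2 + ‖z k‖)) atTop atTop := by
  have h1 : Tendsto (fun k => L k / Real.log ((2 + B) + A * L k)) atTop atTop :=
    (gce_tendsto_div_log_affine (by linarith : (1 : ℝ) < 2 + B) hA).comp hL
  refine tendsto_atTop_mono' atTop ?_ h1
  filter_upwards [hL.eventually_ge_atTop 0] with k hk
  have hlogz : 0 < Real.log (2 + ‖z k‖) := Real.log_pos (by linarith [norm_nonneg (z k)])
  have hlog' : Real.log (2 + ‖z k‖) ≤ Real.log ((2 + B) + A * L k) :=
    Real.log_le_log (by linarith [norm_nonneg (z k)]) (by linarith [hnorm k])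
  have habs : L k ≤ |(z k).re| := by
    have := hre k
    rw [abs_of_nonpos (by linarith)]
    linarith
  calc L k / Real.log ((2 + B) + A * L k) ≤ L k / Real.log (2 + ‖z k‖) :=
        div_le_div_of_nonneg_left hk hlogz hlog'
    _ ≤ |(z k).re| / Real.log (2 + ‖z k‖) := div_le_div_of_nonneg_right habs hlogz.le

/-! ## Part B. The degree-one escape engine -/

/-- `Re (i/α) = Im α / ‖α‖²`. -/
theorem gce_re_I_div (α : ℂ) : (I / α).re = α.im / Complex.normSq α := by
  rw [div_eq_mul_inv, Complex.mul_re, Complex.inv_re, Complex.inv_im]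
  simp
  ring

/-- **The degree-one escape engine.**  `R(z) = α z + β` with `Im α ≠ 0`; `Q` non-constant with
`Q(0) ≠ 0`; `E` entire with `‖E(z)‖ ≤ C_B e^{δ Re z}` for `Re z ≤ 0`, `|Re R(z)| ≤ B`.  Then
`Q(e^{R(z)}) + E(z)` has zeros `z_k` with `Re z_k ≤ -L_k`, `‖z_k‖ ≤ A L_k + B'`, `L_k → ∞`
(`A > 0`, `B' ≥ 0`). (new) -/
theorem exists_escape_zeros_deg_one (R Q : Polynomial ℂ) (α β : ℂ) (hα : α.im ≠ 0)
    (hR : ∀ z, R.eval z = α * z + β) (hQ0 : Q.eval 0 ≠ 0) (hQd : 0 < Q.natDegree)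
    (E : ℂ → ℂ) (hE : Differentiable ℂ E) {δ : ℝ} (hδ : 0 < δ)
    (hEb : ∀ B : ℝ, ∃ C : ℝ, 0 ≤ C ∧
      ∀ z : ℂ, z.re ≤ 0 → |(R.eval z).re| ≤ B → ‖E z‖ ≤ C * Real.exp (δ * z.re)) :
    ∃ (z : ℕ → ℂ) (L : ℕ → ℝ) (A B' : ℝ), 0 < A ∧ 0 ≤ B' ∧ Tendsto L atTop atTop ∧
      ∀ k, Q.eval (exp (R.eval (z k))) + E (z k) = 0 ∧ (z k).re ≤ -L k ∧
        ‖z k‖ ≤ A * L k + B' := by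
  -- a nonzero root `θ` of `Q`
  have hα0 : α ≠ 0 := by
    rintro rfl
    exact hα (by simp)
  have hαpos : 0 < ‖α‖ := norm_pos_iff.2 hα0
  obtain ⟨θ, hθ⟩ := Complex.exists_root (Polynomial.natDegree_pos_iff_degree_pos.1 hQd)
  have hθ0 : θ ≠ 0 := by
    rintro rfl
    exact hQ0 hθ
  set c₀ : ℂ := Complex.log θ with hc₀_def
  have hc₀ : exp c₀ = θ := Complex.exp_log hθ0
  -- the sign making `Re (2πiε/α) < 0`
  set ε : ℝ := if 0 < α.im then -1 else 1 with hε_def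
  have hεα : ε * α.im < 0 := by
    rw [hε_def]
    split_ifs with h
    · linarith
    · have : α.im < 0 := lt_of_le_of_ne (not_lt.1 h) hα
      linarith
  -- the rate `κ = -2π ε Im α / ‖α‖² > 0` of `Re z₀`
  set κ : ℝ := -(2 * Real.pi * ε * (α.im / Complex.normSq α)) with hκ_def
  have hnsq : 0 < Complex.normSq α := Complex.normSq_pos.2 hα0
  have hκ : 0 < κ := by
    rw [hκ_def]
    have : 2 * Real.pi * ε * (α.im / Complex.normSq α) =
        (2 * Real.pi / Complex.normSq α) * (ε * α.im) := by ring
    rw [this]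
    have h2 : 0 < 2 * Real.pi / Complex.normSq α := div_pos Real.two_pi_pos hnsq
    nlinarith
  -- the explicit roots `z₀(k) = (2πi ε (k+1) + c₀ - β)/α`
  set z₀ : ℕ → ℂ := fun k => (2 * Real.pi * I * (ε : ℂ) * ((k : ℂ) + 1) + c₀ - β) / α with hz₀_def
  have hRz₀ : ∀ k, R.eval (z₀ k) = 2 * Real.pi * I * (ε : ℂ) * ((k : ℂ) + 1) + c₀ := by
    intro k
    rw [hR, hz₀_def]
    field_simp
    ring
  have hεint : ∃ n : ℤ, (ε : ℂ) = (n : ℂ) := by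
    rw [hε_def]
    split_ifs
    · exact ⟨-1, by simp⟩
    · exact ⟨1, by simp⟩
  obtain ⟨nε, hnε⟩ := hεint
  have hexpz₀ : ∀ k, exp (R.eval (z₀ k)) = θ := by
    intro k
    rw [hRz₀, Complex.exp_add, hc₀]
    have : exp (2 * Real.pi * I * (ε : ℂ) * ((k : ℂ) + 1)) = 1 := by
      rw [hnε]
      have e : 2 * Real.pi * I * (nε : ℂ) * ((k : ℂ) + 1) = ((nε * (k + 1) : ℤ) : ℂ) * (2 * Real.pi * I) := by
        push_cast; ring
      rw [e]
      exact Complex.exp_int_mul_two_pi_mul_I _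
    rw [this, one_mul]
  have hRez₀re : ∀ k, (R.eval (z₀ k)).re = Real.log ‖θ‖ := by
    intro k
    rw [hRz₀, Complex.add_re, hc₀_def, Complex.log_re]
    have : (2 * Real.pi * I * (ε : ℂ) * ((k : ℂ) + 1)).re = 0 := by
      simp [Complex.mul_re]
    rw [this, zero_add]
  -- `Re z₀(k) = -κ (k+1) + C₀`, `‖z₀ k‖ ≤ (2π/‖α‖)(k+1) + C₁`
  set C₀ : ℝ := ((c₀ - β) / α).re with hC₀
  have hrez₀ : ∀ k, (z₀ k).re = -κ * ((k : ℝ) + 1) + C₀ := by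
    intro k
    have e : z₀ k = (2 * Real.pi * ε * ((k : ℝ) + 1) : ℝ) * (I / α) + (c₀ - β) / α := by
      rw [hz₀_def]; push_cast; field_simp; ring
    rw [e, Complex.add_re, Complex.re_ofReal_mul, gce_re_I_div, hκ_def, hC₀]
    ring
  set C₁ : ℝ := ‖(c₀ - β) / α‖ with hC₁
  have hnormz₀ : ∀ k, ‖z₀ k‖ ≤ 2 * Real.pi / ‖α‖ * ((k : ℝ) + 1) + C₁ := by
    intro k
    have e : z₀ k = (2 * Real.pi * I * (ε : ℂ) * ((k : ℂ) + 1)) / α + (c₀ - β) / α := by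
      rw [hz₀_def]; field_simp; ring
    rw [e]
    refine (norm_add_le _ _).trans (add_le_add ?_ le_rfl)
    rw [norm_div, div_le_iff₀ hαpos]
    have hεn : ‖(ε : ℂ)‖ = 1 := by
      rw [Complex.norm_real, hε_def]; split_ifs <;> simp
    have hk1 : ‖((k : ℂ) + 1)‖ = (k : ℝ) + 1 := by
      rw [show ((k : ℂ) + 1) = (((k : ℝ) + 1 : ℝ) : ℂ) by push_cast; ring, Complex.norm_real,
        Real.norm_eq_abs, abs_of_nonneg (by positivity)]
    rw [norm_mul, norm_mul, norm_mul, norm_mul, hεn, hk1, Complex.norm_I, Complex.norm_real,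
      Complex.norm_ofNat, Real.norm_eq_abs, abs_of_pos Real.pi_pos]
    have : 2 * Real.pi / ‖α‖ * ((k : ℝ) + 1) * ‖α‖ = 2 * Real.pi * ((k : ℝ) + 1) := by
      field_simp
    rw [this]; ring_nf; rfl
  -- the limit function `h(u) = Q(θ e^u)`
  set h : ℂ → ℂ := fun u => Q.eval (θ * exp u) with hh_def
  have hh : Differentiable ℂ h :=
    (Polynomial.differentiable Q).comp ((differentiable_const θ).mul differentiable_exp)
  have hh0 : h 0 = 0 := by
    simp only [hh_def, Complex.exp_zero, mul_one]; exact hθ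
  have hhne : ∃ u, h u ≠ 0 := by
    by_contra hall
    push Not at hall
    have hinf : Set.Infinite {x : ℂ | Q.IsRoot x} := by
      have hinj : Function.Injective (fun t : ℝ => θ * exp (t : ℂ)) := by
        intro t₁ t₂ ht
        have h1 : exp (t₁ : ℂ) = exp (t₂ : ℂ) := mul_left_cancel₀ hθ0 ht
        have h2 : Real.exp t₁ = Real.exp t₂ := by
          have := congrArg norm h1
          rwa [Complex.norm_exp, Complex.norm_exp, Complex.ofReal_re, Complex.ofReal_re] at this
        exact Real.exp_injective h2
      have hsub : Set.range (fun t : ℝ => θ * exp (t : ℂ)) ⊆ {x : ℂ | Q.IsRoot x} := by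
        rintro _ ⟨t, rfl⟩
        exact hall t
      exact (Set.infinite_range_of_injective hinj).mono hsub
    exact (Polynomial.ne_zero_of_natDegree_gt hQd) (Polynomial.eq_zero_of_infinite_isRoot Q hinf)
  -- the rescaled functions `G_k(u) = g(z₀ k + u/α)` and their uniform convergence to `h`
  set G : ℕ → ℂ → ℂ := fun k u =>
    Q.eval (exp (R.eval (z₀ k + u / α))) + E (z₀ k + u / α) with hG_def
  have hGdiff : ∀ k, Differentiable ℂ (G k) := by
    intro k
    have hφ : Differentiable ℂ (fun u : ℂ => z₀ k + u / α) :=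
      (differentiable_const _).add (differentiable_id.div_const _)
    exact ((Polynomial.differentiable Q).comp (((Polynomial.differentiable R).comp hφ).cexp)).add
      (hE.comp hφ)
  have hRφ : ∀ k (u : ℂ), R.eval (z₀ k + u / α) = R.eval (z₀ k) + u := by
    intro k u
    rw [hR, hR]
    field_simp
    ring
  have hkey : ∀ k (u : ℂ), exp (R.eval (z₀ k + u / α)) = θ * exp u := by
    intro k u
    rw [hRφ, Complex.exp_add, hexpz₀]
  obtain ⟨C, hC0, hC⟩ := hEb (|Real.log ‖θ‖| + 1)
  have hz₀re_tendsto : Tendsto (fun k => (z₀ k).re) atTop atBot := by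
    have h1 : Tendsto (fun k : ℕ => -κ * ((k : ℝ) + 1) + C₀) atTop atBot :=
      tendsto_atBot_add_const_right _ C₀
        ((tendsto_natCast_add_atTop 1).const_mul_atTop_of_neg (by linarith))
    exact h1.congr fun k => (hrez₀ k).symm
  have hunif : ∀ η : ℝ, 0 < η → ∀ᶠ k in atTop, ∀ u ∈ closedBall (0 : ℂ) 1, ‖G k u - h u‖ < η := by
    intro η hη
    have hev : ∀ᶠ k in atTop, C * Real.exp (δ * ((z₀ k).re + 1 / ‖α‖)) < η ∧
        (z₀ k).re + 1 / ‖α‖ ≤ 0 := by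
      have h1 : Tendsto (fun k => δ * ((z₀ k).re + 1 / ‖α‖)) atTop atBot :=
        (tendsto_atBot_add_const_right _ _ hz₀re_tendsto).const_mul_atBot hδ
      have h2 : Tendsto (fun k => C * Real.exp (δ * ((z₀ k).re + 1 / ‖α‖))) atTop (𝓝 (C * 0)) :=
        (Real.tendsto_exp_atBot.comp h1).const_mul C
      rw [mul_zero] at h2
      exact (h2.eventually (gt_mem_nhds hη)).and
        ((tendsto_atBot_add_const_right _ _ hz₀re_tendsto).eventually (eventually_le_atBot 0))
    filter_upwards [hev] with k hk u hu
    rw [mem_closedBall, dist_zero_right] at hu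
    have hre1 : (z₀ k + u / α).re ≤ (z₀ k).re + 1 / ‖α‖ := by
      rw [Complex.add_re]
      have h1 := re_le_norm (u / α)
      rw [norm_div] at h1
      have h2 : ‖u‖ / ‖α‖ ≤ 1 / ‖α‖ := div_le_div_of_nonneg_right hu hαpos.le
      linarith
    have hre0 : (z₀ k + u / α).re ≤ 0 := hre1.trans hk.2
    have hReR : |(R.eval (z₀ k + u / α)).re| ≤ |Real.log ‖θ‖| + 1 := by
      rw [hRφ, Complex.add_re, hRez₀re]
      have h1 := abs_re_le_norm u
      have h3 := abs_add_le (Real.log ‖θ‖) u.re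
      linarith
    have h5 := hC _ hre0 hReR
    have hGh : G k u - h u = E (z₀ k + u / α) := by
      simp only [hG_def, hh_def, hkey]; ring
    rw [hGh]
    refine h5.trans_lt (lt_of_le_of_lt ?_ hk.1)
    exact mul_le_mul_of_nonneg_left (Real.exp_le_exp.2 (mul_le_mul_of_nonneg_left hre1 hδ.le)) hC0
  -- persistence
  have hzeros := eventually_exists_zero_of_unif_approx hh hhne hh0 hGdiff zero_lt_one hunif
  obtain ⟨K₁, hK₁⟩ := eventually_atTop.1 (hzeros.and
    ((tendsto_atBot_add_const_right _ _ hz₀re_tendsto).eventually (eventually_le_atBot (0 : ℝ)) :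
      ∀ᶠ k in atTop, (z₀ k).re + 1 / ‖α‖ ≤ 0))
  have hsol : ∀ k : ℕ, ∃ u : ℂ, ‖u‖ ≤ 1 ∧ G (k + K₁) u = 0 := by
    intro k
    obtain ⟨⟨u, hu, hu0⟩, -⟩ := hK₁ (k + K₁) (Nat.le_add_left _ _)
    rw [mem_ball, dist_zero_right] at hu
    exact ⟨u, hu.le, hu0⟩
  choose u hu1 hu0 using hsol
  -- bookkeeping: `L_k = κ (k + K₁ + 1) - C₀ - 1/‖α‖`
  refine ⟨fun k => z₀ (k + K₁) + u k / α, fun k => κ * (((k + K₁ : ℕ) : ℝ) + 1) - C₀ - 1 / ‖α‖,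
    2 * Real.pi / (‖α‖ * κ), |2 * Real.pi / (‖α‖ * κ) * (C₀ + 1 / ‖α‖)| + C₁ + 1 / ‖α‖,
    by positivity, by positivity, ?_, fun k => ⟨hu0 k, ?_, ?_⟩⟩
  · have h1 : Tendsto (fun k : ℕ => κ * (((k + K₁ : ℕ) : ℝ) + 1)) atTop atTop := by
      have := ((tendsto_natCast_add_atTop 1).comp (tendsto_add_atTop_nat K₁)).const_mul_atTop hκ
      refine this.congr fun k => ?_
      simp only [Function.comp_apply]
    have h2 := tendsto_atTop_add_const_right _ (-C₀ - 1 / ‖α‖) h1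
    exact h2.congr fun k => by ring
  · have h1 := re_le_norm (u k / α)
    rw [norm_div] at h1
    have h2 : ‖u k‖ / ‖α‖ ≤ 1 / ‖α‖ := div_le_div_of_nonneg_right (hu1 k) hαpos.le
    rw [Complex.add_re, hrez₀]
    push_cast
    linarith
  · have h1 : ‖z₀ (k + K₁) + u k / α‖ ≤ ‖z₀ (k + K₁)‖ + 1 / ‖α‖ := by
      refine (norm_add_le _ _).trans (add_le_add le_rfl ?_)
      rw [norm_div]; exact div_le_div_of_nonneg_right (hu1 k) hαpos.le
    have h2 := hnormz₀ (k + K₁)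
    have h3 : 2 * Real.pi / ‖α‖ * (((k + K₁ : ℕ) : ℝ) + 1) =
        2 * Real.pi / (‖α‖ * κ) * (κ * (((k + K₁ : ℕ) : ℝ) + 1) - C₀ - 1 / ‖α‖) +
          2 * Real.pi / (‖α‖ * κ) * (C₀ + 1 / ‖α‖) := by
      field_simp
      ring
    have h4 := le_abs_self (2 * Real.pi / (‖α‖ * κ) * (C₀ + 1 / ‖α‖))
    push_cast at h2 h3 ⊢
    linarith

/-! ## Part C. Escaping exponential points of `{x₁ = a x₀ + b} × Z(P)` for `Im a ≠ 0` -/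

/-- **Escaping zeros of `P(e^z, e^{az+b})`, non-real slope.**  Let `Im a ≠ 0` and let
`P ∈ ℂ[y₀, y₁]` have two monomials with different `y₁`-exponents.  Then there are `z_k` with
`P(e^{z_k}, e^{a z_k + b}) = 0` and `|Re z_k| / log(2 + ‖z_k‖) → ∞`. (new) -/
theorem exists_lineCurve_expPoints_of_im_ne_zero (a b : ℂ) (ha : a.im ≠ 0)
    (P : MvPolynomial (Fin 2) ℂ) (h2 : ∃ v ∈ P.support, ∃ v' ∈ P.support, v 1 ≠ v' 1) :
    ∃ z : ℕ → ℂ, (∀ k, MvPolynomial.eval ![exp (z k), exp ((linePoly a b).eval (z k))] P = 0) ∧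
      Tendsto (fun k => |(z k).re| / Real.log (2 + ‖z k‖)) atTop atTop := by
  classical
  obtain ⟨s, vb, hvb, hE1, hE2, hE3⟩ := exists_lowerLeft_edge P.support h2
  -- the polynomial `R₀ = (a + s) X + b`
  set R₀ : Polynomial ℂ := linePoly a b + Polynomial.C (s : ℂ) * Polynomial.X with hR₀
  have hR : ∀ z, R₀.eval z = (a + s) * z + b := by
    intro z
    rw [hR₀, Polynomial.eval_add, eval_linePoly, Polynomial.eval_mul, Polynomial.eval_C,
      Polynomial.eval_X]
    ring
  have hα : (a + (s : ℂ)).im ≠ 0 := by simpa using ha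
  -- the edge polynomial
  set Q : Polynomial ℂ := ∑ v ∈ P.support.filter
      (fun v : Fin 2 →₀ ℕ => ((v 0 : ℝ) - s * v 1) = (vb 0 : ℝ) - s * vb 1),
    Polynomial.C (P.coeff v) * Polynomial.X ^ (v 1 - vb 1) with hQ
  have hQ0 : Q.eval 0 ≠ 0 := by
    rw [hQ, eval_zero_edgePoly hvb hE2]
    exact MvPolynomial.mem_support_iff.1 hvb
  have hQd : 0 < Q.natDegree := natDegree_edgePoly_pos hE2 hE3
  -- the off-edge part and its weight gap `δ`
  set N := P.support.filter
    (fun v : Fin 2 →₀ ℕ => ¬ ((v 0 : ℝ) - s * v 1) = (vb 0 : ℝ) - s * vb 1) with hN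
  obtain ⟨δ, hδpos, hδ⟩ : ∃ δ : ℝ, 0 < δ ∧ ∀ v ∈ P.support,
      ¬ ((v 0 : ℝ) - s * v 1) = (vb 0 : ℝ) - s * vb 1 →
        δ ≤ ((v 0 : ℝ) - s * v 1) - ((vb 0 : ℝ) - s * vb 1) := by
    by_cases hNe : N.Nonempty
    · obtain ⟨vm, hvm, hvmmin⟩ := N.exists_min_image
        (fun v => ((v 0 : ℝ) - s * v 1) - ((vb 0 : ℝ) - s * vb 1)) hNe
      obtain ⟨hvmA, hvmw⟩ := Finset.mem_filter.1 hvm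
      refine ⟨((vm 0 : ℝ) - s * vm 1) - ((vb 0 : ℝ) - s * vb 1), ?_, fun v hv hvw =>
        hvmmin v (Finset.mem_filter.2 ⟨hv, hvw⟩)⟩
      have := hE1 vm hvmA
      rcases this.lt_or_eq with h | h
      · linarith
      · exact absurd h.symm hvmw
    · refine ⟨1, zero_lt_one, fun v hv hvw => ?_⟩
      exact absurd ⟨v, Finset.mem_filter.2 ⟨hv, hvw⟩⟩ hNe
  set E : ℂ → ℂ := fun z => ∑ v ∈ N,
    P.coeff v * exp ((((v 0 : ℝ) - s * v 1 - ((vb 0 : ℝ) - s * vb 1) : ℝ) : ℂ) * z +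
      (((v 1 : ℝ) - vb 1 : ℝ) : ℂ) * R₀.eval z) with hEdef
  have hEdiff : Differentiable ℂ E := differentiable_offEdgeSum
  have hEb : ∀ B : ℝ, ∃ C : ℝ, 0 ≤ C ∧
      ∀ z : ℂ, z.re ≤ 0 → |(R₀.eval z).re| ≤ B → ‖E z‖ ≤ C * Real.exp (δ * z.re) := by
    intro B
    refine ⟨∑ v ∈ N, ‖P.coeff v‖ * Real.exp (|(v 1 : ℝ) - vb 1| * B),
      Finset.sum_nonneg fun v _ => by positivity, fun z hz hzB => ?_⟩
    exact norm_offEdgeSum_le hδ hz hzB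
  -- the engine
  obtain ⟨z, L, A, B', hA, hB', hL, hz⟩ :=
    exists_escape_zeros_deg_one R₀ Q (a + s) b hα hR hQ0 hQd E hEdiff hδpos hEb
  refine ⟨z, fun k => ?_, tendsto_abs_re_div_log_of_linear' hL hA hB' (fun k => (hz k).2.1)
    (fun k => (hz k).2.2)⟩
  rw [eval_exp_eq_mul_edgeSum hE2 (z k)]
  have h := (hz k).1
  rw [hQ, hEdef] at h
  rw [h, mul_zero]

end Summit.Schanuel.Schanuel.Theorems
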